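import Summits.Parity.BatemanHorn.Theses.SelbergDelangeRigidity
import Summits.Parity.BatemanHorn.Theorems.SystemLSDRealSegment.Negative.Engines
import Summits.Parity.BatemanHorn.Theorems.SystemLSDRealSegment.Negative.OmegaWide
import Literature.NumberTheory.LFunctions.SelbergDelangeOmegaProofs

/-!
# `LSDRealSegment` — the linear rung `f = X`: the crux HOLDS there, its `Λ` is rigid, and the radius `2` is sharp

Support for crux `stmt-Parity-9770` (`Summit.Parity.BatemanHorn.Theses.SelbergDelangeRigidity.LSDRealSegment`), standing
disprover cycle 2 (refuter-cdisprove-stmt-Parity-9770-g2-0). Work file: `Summits/Parity/BatemanHorn/Cruxes/LSDRealSegment/Disproof.lean` §7.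
Everything is PROVED (no named facts); the analytic input is the tree's proof
`Literature.NumberTheory.LFunctions.MontgomeryVaughan2007_thm_7_18_Omega_holds` of Selberg's theorem
`Σ_{n≤x} z^{Ω(n)} = F(1,z)Γ(z)⁻¹ x (log x)^{z-1} + O(x (log x)^{Re z-2})` (`|z| ≤ R < 2`).

* `differentiableOn_selbergDelangeOmegaF` — Selberg's Euler product `F(1,z) = ∏_p (1 - z/p)⁻¹(1 - 1/p)^z`
  (`Literature.NumberTheory.LFunctions.selbergDelangeOmegaF`) is HOLOMORPHIC on `|z| < 2` (locally uniform product of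
  the holomorphic factors `E_p(1,·)`; not previously in the tree — it is the `EulerFactor` bookkeeping of the route's
  two-layer plan at `k = 1`, `deg = 1`).
* `lsdRealSegment_conclusion_X` — the `k = 1`, `f = X` instance of the crux HOLDS with `Λ = F(1,·)`: full calibration of
  the typed normalisation (`x⁻¹`, `(log x)^{k(1-y)}` via `exp(k(1-y) log log x)`, `D^{y-1}` with `D = 1`, `Γ(y)^{-k}`, the
  junk terms `n = 0`, `x ≤ 2`) AND of the pin `Λ 0 = C(f)` (`F(1,0) = 1 = C(X)`) against a proved theorem. No
  misstatement refutation of the crux exists at the linear rung.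
* `eqOn_selbergDelangeOmegaF_of_omegaSegmentLaw_X`, `apply_zero_eq_one_of_omegaSegmentLaw_X` — RIGIDITY: every `Λ`
  holomorphic on `|z| < 2` satisfying the crux's segment law for `(X)` IS `F(1,·)` on the ball; its value at `0` is forced
  to be `1`.
* Sequel `Negative/SharpRadius.lean`: `Re F(1,y) ≥ ¼(1 - y/2)⁻¹` on `[1, 2)` and the refuted strengthening
  `not_lsdRealSegment_ball` (holomorphy radius `2` is sharp).
-/

open Filter Polynomial Finset
open scoped Topology

namespace Summit.Parity.BatemanHorn.Theorems.LSDRealSegment.Negative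

open Literature.NumberTheory.Sieve
open Summit.Parity.BatemanHorn.Theorems.SystemLSDRealSegment.Negative
open ArithmeticFunction (cardFactors)
open Literature.NumberTheory.LFunctions
open Literature.NumberTheory.LFunctions.SelbergDelangeOmega

noncomputable section

/-! ## Holomorphy of Selberg's `F(1,·)` on `|z| < 2` -/

/-- Each Euler factor `z ↦ E_p(1, z) = (1 - z/p)⁻¹ (1 - 1/p)^z` is holomorphic on `|z| < 2` (`p ≥ 2 > |z|`).
[cite: MontgomeryVaughan2007, §7.4 (7.60)] -/
theorem differentiableOn_eulerFactor_one (p : Nat.Primes) :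
    DifferentiableOn ℂ (fun z : ℂ => eulerFactor p 1 z) (Metric.ball 0 2) := by
  intro z hz
  have hz2 : ‖z‖ < 2 := by simpa [Metric.mem_ball, dist_zero_right] using hz
  have hne : (1 : ℂ) - z * ((p : ℕ) : ℂ) ^ (-(1 : ℂ)) ≠ 0 :=
    one_sub_ne_zero (R := ‖z‖) hz2 le_rfl (by simp only [sigma0, Complex.one_re]; linarith [norm_nonneg z])
  refine DifferentiableAt.differentiableWithinAt ?_
  unfold eulerFactor
  fun_prop (disch := exact hne)

/-- `F(1, ·) = ∏_p E_p(1, ·)` converges locally uniformly on `|z| < 2`. [cite: MontgomeryVaughan2007, §7.4 (7.60)] -/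
theorem hasProdLocallyUniformlyOn_eulerFactor_one :
    HasProdLocallyUniformlyOn (fun (p : Nat.Primes) (z : ℂ) => eulerFactor p 1 z) (fun z => bigOmegaF 1 z)
      (Metric.ball 0 2) := by
  apply hasProdLocallyUniformlyOn_of_forall_compact Metric.isOpen_ball
  intro K hK hcK
  obtain ⟨R, hR2, hKR⟩ := exists_lt_subset_ball hcK.isClosed hK
  have hu : Summable fun p : Nat.Primes ↦ 5 * (R + R ^ 2) * ((p : ℕ) : ℝ) ^ (-(2 * (1 : ℝ))) :=
    ((Nat.Primes.summable_rpow (r := -(2 * (1 : ℝ)))).2 (by norm_num)).mul_left _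
  have hev : ∀ᶠ p : Nat.Primes in cofinite, ∀ z ∈ K,
      ‖(eulerFactor p 1 z - 1)‖ ≤ 5 * (R + R ^ 2) * ((p : ℕ) : ℝ) ^ (-(2 * (1 : ℝ))) := by
    filter_upwards [eventually_norm_eulerFactor_sub_one_le (σ₁ := 1) one_pos R] with p hp z hz
    have hzR : ‖z‖ ≤ R := by
      have := hKR hz
      rw [Metric.mem_ball, dist_zero_right] at this
      exact this.le
    exact hp 1 z (by simp) hzR
  have hcts : ∀ p : Nat.Primes, ContinuousOn (fun z => eulerFactor p 1 z - 1) K := fun p =>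
    (((differentiableOn_eulerFactor_one p).continuousOn.mono hK).sub continuousOn_const)
  have h := hu.hasProdUniformlyOn_one_add hcK hev hcts
  simp only [add_sub_cancel] at h
  simpa only [bigOmegaF] using h

/-- **`F(1,·) = selbergDelangeOmegaF` is holomorphic on `|z| < 2`** (the `Λ` of the crux at `f = X`).
[cite: MontgomeryVaughan2007, §7.4 (7.60)] -/
theorem differentiableOn_selbergDelangeOmegaF : DifferentiableOn ℂ selbergDelangeOmegaF (Metric.ball 0 2) := by
  have hd : DifferentiableOn ℂ (fun z => bigOmegaF 1 z) (Metric.ball 0 2) :=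
    hasProdLocallyUniformlyOn_eulerFactor_one.differentiableOn
      (.of_forall fun s => by
        simpa [Finset.prod_fn] using
          DifferentiableOn.finsetProd (u := s) (fun p _ => differentiableOn_eulerFactor_one p))
      Metric.isOpen_ball
  exact hd.congr fun z _ => (bigOmegaF_one z).symm

/-- `F(1, 0) = 1` (`= C(X)`). [cite: MontgomeryVaughan2007, §7.4 (7.60)] -/
theorem selbergDelangeOmegaF_zero : selbergDelangeOmegaF 0 = 1 := by
  simp [selbergDelangeOmegaF_apply]


/-! ## Selberg's theorem gives the segment law at `f = X` with `Λ = F(1,·)` -/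

/-- The sum of the crux for `f = X` is `1 + A_z(x)`, `A_z(x) = Σ_{1 ≤ n ≤ x} z^{Ω(n)}`. [folklore] -/
theorem sum_X_eq (x : ℕ) (z : ℂ) :
    ∑ n ∈ Finset.range (x + 1), z ^ (∑ i, cardFactors ((((![X] : Fin 1 → ℤ[X]) i).eval (n : ℤ)).toNat)) =
      1 + ∑ n ∈ Finset.Icc 1 x, z ^ cardFactors n := by
  have h : ∀ n : ℕ, (∑ i, cardFactors ((((![X] : Fin 1 → ℤ[X]) i).eval (n : ℤ)).toNat)) = cardFactors n :=
    fun n => by simp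
  simp_rw [h]
  rw [Nat.range_succ_eq_Icc_zero, Finset.Icc_eq_cons_Ioc (Nat.zero_le x), Finset.sum_cons,
    ← Finset.Icc_add_one_left_eq_Ioc, zero_add]
  simp

/-- The archimedean factor at `f = X` is `Γ(y)⁻¹` (`D = natDegree X = 1`, `log 1 = 0`). [folklore] -/
theorem archFactor_X (y : ℝ) :
    Complex.exp (((y : ℂ) - 1) * (Real.log (∏ i, (((![X] : Fin 1 → ℤ[X]) i).natDegree : ℝ)) : ℂ)) *
      (Complex.Gamma y)⁻¹ ^ 1 = (Complex.Gamma y)⁻¹ := by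
  simp

/-- The normaliser cancels the main-term power: `e^{(1-y) log L} · L^{y-1} = 1` for `L > 0`. [folklore] -/
theorem exp_mul_cpow_eq_one {L : ℝ} (hL : 0 < L) (w : ℂ) :
    Complex.exp (((1 : ℕ) : ℂ) * (1 - w) * (Real.log L : ℂ)) * ((L : ℂ) ^ (w - 1)) = 1 := by
  rw [Complex.cpow_def_of_ne_zero (by exact_mod_cast hL.ne'), ← Complex.ofReal_log hL.le, ← Complex.exp_add]
  convert Complex.exp_zero using 2
  push_cast
  ring

/-- Norm of the normaliser: `‖e^{(1-y) log L}‖ = L^{1-y} ≤ 1` for `L ≥ 1`, `y ≥ 1`. [folklore] -/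
theorem norm_exp_normaliser_le_one {L y : ℝ} (hL : 1 ≤ L) (hy : 1 ≤ y) :
    ‖Complex.exp (((1 : ℕ) : ℂ) * (1 - (y : ℂ)) * (Real.log L : ℂ))‖ ≤ 1 := by
  rw [Complex.norm_exp]
  have hre : (((1 : ℕ) : ℂ) * (1 - (y : ℂ)) * (Real.log L : ℂ)).re = (1 - y) * Real.log L := by
    simp [Complex.mul_re]
  rw [hre, Real.exp_le_one_iff]
  exact mul_nonpos_of_nonpos_of_nonneg (by linarith) (Real.log_nonneg hL)

/-- **SEGMENT LAW AT `f = X`** (indeed for every real `1 ≤ y < 2`): Selberg's theorem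
(`MontgomeryVaughan2007_thm_7_18_Omega`, PROVED in the tree) gives
`x⁻¹ (log x)^{1-y} Σ_{n ≤ x} y^{Ω(n)} → F(1,y)/Γ(y)`. [cite: MontgomeryVaughan2007, §7.4 Theorem 7.18 and (7.60)] -/
theorem tendsto_normSum_X {y : ℝ} (hy1 : 1 ≤ y) (hy2 : y < 2) :
    Tendsto (fun x : ℕ => (x : ℂ)⁻¹ * Complex.exp (((1 : ℕ) : ℂ) * (1 - (y : ℂ)) * (Real.log (Real.log x) : ℂ)) *
      ∑ n ∈ Finset.range (x + 1), (y : ℂ) ^ (∑ i, cardFactors ((((![X] : Fin 1 → ℤ[X]) i).eval (n : ℤ)).toNat)))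
      atTop (𝓝 (selbergDelangeOmegaF y * (Complex.Gamma y)⁻¹)) := by
  obtain ⟨C, hC⟩ := MontgomeryVaughan2007_thm_7_18_Omega_holds y hy2
  set w : ℂ := (y : ℂ) with hw
  set G : ℂ := selbergDelangeOmegaF w * (Complex.Gamma w)⁻¹ with hG
  have hwn : ‖w‖ ≤ y := by rw [hw, Complex.norm_real, Real.norm_eq_abs, abs_of_nonneg (by linarith)]
  -- the bound `‖Q x - G‖ ≤ x⁻¹ + max C 0 · (log x)⁻¹` for `x ≥ 3`
  have hbound : ∀ x : ℕ, 3 ≤ x →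
      ‖(x : ℂ)⁻¹ * Complex.exp (((1 : ℕ) : ℂ) * (1 - w) * (Real.log (Real.log x) : ℂ)) *
          ∑ n ∈ Finset.range (x + 1), w ^ (∑ i, cardFactors ((((![X] : Fin 1 → ℤ[X]) i).eval (n : ℤ)).toNat))
        - G‖ ≤ (x : ℝ)⁻¹ + max C 0 * (Real.log x) ^ (-(2 - y)) := by
    intro x hx
    have hx0 : (0 : ℝ) < x := by exact_mod_cast (show 0 < x by omega)
    have hx2 : (2 : ℝ) ≤ x := by exact_mod_cast (show 2 ≤ x by omega)
    have hL : 1 < Real.log x := by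
      rw [Real.lt_log_iff_exp_lt hx0]
      have := Real.exp_one_lt_d9
      have h3 : (3 : ℝ) ≤ x := by exact_mod_cast hx
      linarith
    have hL0 : 0 < Real.log x := by linarith
    set L : ℝ := Real.log x with hLdef
    set S : ℂ := ∑ n ∈ Finset.Icc 1 x, w ^ cardFactors n with hS
    set M : ℂ := selbergDelangeOmegaF w * (Complex.Gamma w)⁻¹ * (x : ℂ) * ((L : ℝ) : ℂ) ^ (w - 1) with hM
    have hMV : ‖S - M‖ ≤ C * x * L ^ (y - 2) := by
      have := hC x hx2 w hwn
      rwa [Nat.floor_natCast] at this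
    have hMV' : ‖S - M‖ ≤ max C 0 * x * L ^ (y - 2) := by
      refine hMV.trans ?_
      gcongr
      exact le_max_left _ _
    set e : ℂ := Complex.exp (((1 : ℕ) : ℂ) * (1 - w) * (Real.log L : ℂ)) with he
    have he1 : e * ((L : ℂ) ^ (w - 1)) = 1 := exp_mul_cpow_eq_one hL0 w
    have hxne : (x : ℂ) ≠ 0 := by exact_mod_cast (show (x : ℕ) ≠ 0 by omega)
    have hxinv : (x : ℂ)⁻¹ * (x : ℂ) = 1 := inv_mul_cancel₀ hxne
    have hkey : (x : ℂ)⁻¹ * e * (1 + S) - G = (x : ℂ)⁻¹ * e * (1 + (S - M)) := by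
      rw [hM, ← hG]
      linear_combination G * hxinv + G * ((x : ℂ)⁻¹ * (x : ℂ)) * he1
    rw [sum_X_eq, hkey]
    have hne : ‖e‖ ≤ 1 := norm_exp_normaliser_le_one hL.le hy1
    have hxinvR : ‖(x : ℂ)⁻¹‖ = (x : ℝ)⁻¹ := by simp
    calc ‖(x : ℂ)⁻¹ * e * (1 + (S - M))‖ = (x : ℝ)⁻¹ * ‖e‖ * ‖1 + (S - M)‖ := by
          rw [norm_mul, norm_mul, hxinvR]
      _ ≤ (x : ℝ)⁻¹ * 1 * (1 + max C 0 * x * L ^ (y - 2)) := by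
          gcongr
          exact (norm_add_le _ _).trans (by simpa using hMV')
      _ = (x : ℝ)⁻¹ + max C 0 * L ^ (y - 2) := by field_simp
      _ = (x : ℝ)⁻¹ + max C 0 * L ^ (-(2 - y)) := by rw [show y - 2 = -(2 - y) by ring]
  -- the right-hand side tends to `0`
  have hrhs : Tendsto (fun x : ℕ => (x : ℝ)⁻¹ + max C 0 * (Real.log x) ^ (-(2 - y))) atTop (𝓝 0) := by
    have h1 : Tendsto (fun x : ℕ => (x : ℝ)⁻¹) atTop (𝓝 0) := tendsto_inv_atTop_nhds_zero_nat
    have h2 : Tendsto (fun x : ℕ => (Real.log x) ^ (-(2 - y))) atTop (𝓝 0) :=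
      (tendsto_rpow_neg_atTop (by linarith : 0 < 2 - y)).comp
        (Real.tendsto_log_atTop.comp tendsto_natCast_atTop_atTop)
    simpa using h1.add (h2.const_mul (max C 0))
  rw [tendsto_iff_norm_sub_tendsto_zero]
  refine squeeze_zero_norm' ?_ hrhs
  filter_upwards [eventually_ge_atTop 3] with x hx
  rw [norm_norm]
  exact hbound x hx

/-- The crux's real-segment law HOLDS for the integers with `Λ = F(1,·)` (target in the crux's own shape).
[cite: MontgomeryVaughan2007, §7.4 Theorem 7.18 and (7.60)] -/
theorem omegaSegmentLaw_X (y : ℝ) (hy : 5 / 4 < y) (hy' : y < 7 / 4) :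
    Tendsto (fun x : ℕ => (x : ℂ)⁻¹ * Complex.exp (((1 : ℕ) : ℂ) * (1 - (y : ℂ)) * (Real.log (Real.log x) : ℂ)) *
      ∑ n ∈ Finset.range (x + 1), (y : ℂ) ^ (∑ i, cardFactors ((((![X] : Fin 1 → ℤ[X]) i).eval (n : ℤ)).toNat)))
      atTop (𝓝 (selbergDelangeOmegaF y * (Complex.exp (((y : ℂ) - 1) *
        (Real.log (∏ i, (((![X] : Fin 1 → ℤ[X]) i).natDegree : ℝ)) : ℂ)) * (Complex.Gamma y)⁻¹ ^ 1))) := by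
  rw [archFactor_X]
  exact tendsto_normSum_X (y := y) (by linarith) (by linarith)

/-- `C(X) = 1`. [folklore] -/
theorem batemanHornConst_X : batemanHornConst (![X] : Fin 1 → ℤ[X]) = 1 := by
  have hpart : batemanHornPartial (![X] : Fin 1 → ℤ[X]) = fun _ => 1 := by
    funext x
    unfold batemanHornPartial
    refine Finset.prod_eq_one fun p hp => ?_
    have hp' := Nat.prime_of_mem_primesLE hp
    have hp0 : (0 : ℝ) < p := by exact_mod_cast hp'.pos
    have hlt : 1 / (p : ℝ) < 1 := by rw [div_lt_one hp0]; exact_mod_cast hp'.one_lt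
    rw [polyRootCountMod_X hp', Fintype.card_fin, pow_one, Nat.cast_one]
    exact inv_mul_cancel₀ (ne_of_gt (by linarith))
  rw [batemanHornConst, hpart]
  exact tendsto_const_nhds.limUnder_eq

/-- **THE CRUX HOLDS AT `f = X`** with `Λ = F(1,·) = ∏_p (1 - z/p)⁻¹(1 - 1/p)^z`: holomorphic on `|z| < 2`
(above), `Λ 0 = 1 = C(X)`, and the segment law is Selberg's theorem. Full calibration of the typed normalisation
(`x⁻¹`, `(log x)^{k(1-y)}`, `D^{y-1}`, `Γ(y)^{-k}`, the pin `Λ 0 = C(f)`) against a theorem PROVED in the tree: no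
misstatement kill exists at the linear rung. [cite: MontgomeryVaughan2007, §7.4 Theorem 7.18 and (7.60)] -/
theorem lsdRealSegment_conclusion_X :
    ∃ Λ : ℂ → ℂ, DifferentiableOn ℂ Λ (Metric.ball 0 2) ∧ Λ 0 = (batemanHornConst (![X] : Fin 1 → ℤ[X]) : ℂ) ∧
      ∀ y : ℝ, 5 / 4 < y → y < 7 / 4 → Filter.Tendsto (fun x : ℕ => (x : ℂ)⁻¹ *
        Complex.exp (((1 : ℕ) : ℂ) * (1 - (y : ℂ)) * (Real.log (Real.log x) : ℂ)) *
        ∑ n ∈ Finset.range (x + 1), (y : ℂ) ^ (∑ i, cardFactors ((((![X] : Fin 1 → ℤ[X]) i).eval (n : ℤ)).toNat)))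
        Filter.atTop (nhds (Λ y * Complex.exp (((y : ℂ) - 1) *
          (Real.log (∏ i, (((![X] : Fin 1 → ℤ[X]) i).natDegree : ℝ)) : ℂ)) * (Complex.Gamma y)⁻¹ ^ 1)) := by
  refine ⟨selbergDelangeOmegaF, differentiableOn_selbergDelangeOmegaF, ?_, fun y hy hy' => ?_⟩
  · rw [selbergDelangeOmegaF_zero, batemanHornConst_X]; simp
  · have := omegaSegmentLaw_X y hy hy'
    simpa [mul_assoc] using this

/-- … which is literally the `k = 1`, `f = X` case of the route decl. -/
example (h : Summit.Parity.BatemanHorn.Theses.SelbergDelangeRigidity.LSDRealSegment) :=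
  h 1 (![X] : Fin 1 → ℤ[X]) isBatemanHornSystem_X


/-! ## Rigidity at `f = X`: the witness `Λ` is forced to be `F(1,·)` -/

/-- RIGIDITY AT `f = X`: every `Λ` holomorphic on `|z| < 2` satisfying the crux's segment law for `(X)` coincides with
Selberg's `F(1,·)` on the ball (limits are unique, the Γ-factor is non-zero, identity theorem). [folklore] -/
theorem eqOn_selbergDelangeOmegaF_of_omegaSegmentLaw_X {Λ : ℂ → ℂ} (hΛ : DifferentiableOn ℂ Λ (Metric.ball 0 2))
    (hlaw : ∀ y : ℝ, 5 / 4 < y → y < 7 / 4 → Tendsto (fun x : ℕ => (x : ℂ)⁻¹ *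
      Complex.exp (((1 : ℕ) : ℂ) * (1 - (y : ℂ)) * (Real.log (Real.log x) : ℂ)) *
      ∑ n ∈ Finset.range (x + 1), (y : ℂ) ^ (∑ i, cardFactors ((((![X] : Fin 1 → ℤ[X]) i).eval (n : ℤ)).toNat)))
      atTop (𝓝 (Λ y * (Complex.exp (((y : ℂ) - 1) *
        (Real.log (∏ i, (((![X] : Fin 1 → ℤ[X]) i).natDegree : ℝ)) : ℂ)) * (Complex.Gamma y)⁻¹ ^ 1)))) :
    Set.EqOn Λ selbergDelangeOmegaF (Metric.ball 0 2) := by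
  refine eqOn_ball_of_eqOn_segment hΛ differentiableOn_selbergDelangeOmegaF fun y hy hy' => ?_
  have := tendsto_nhds_unique (hlaw y hy hy') (omegaSegmentLaw_X y hy hy')
  exact mul_right_cancel₀ (gammaFactor_ne_zero 1 _ (by linarith)) this

/-- … in particular its pinned value is `Λ 0 = F(1,0) = 1 = C(X)`: at the linear rung the clause `Λ 0 = C(f)` is
both FORCED and CORRECT. [folklore] -/
theorem apply_zero_eq_one_of_omegaSegmentLaw_X {Λ : ℂ → ℂ} (hΛ : DifferentiableOn ℂ Λ (Metric.ball 0 2))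
    (hlaw : ∀ y : ℝ, 5 / 4 < y → y < 7 / 4 → Tendsto (fun x : ℕ => (x : ℂ)⁻¹ *
      Complex.exp (((1 : ℕ) : ℂ) * (1 - (y : ℂ)) * (Real.log (Real.log x) : ℂ)) *
      ∑ n ∈ Finset.range (x + 1), (y : ℂ) ^ (∑ i, cardFactors ((((![X] : Fin 1 → ℤ[X]) i).eval (n : ℤ)).toNat)))
      atTop (𝓝 (Λ y * (Complex.exp (((y : ℂ) - 1) *
        (Real.log (∏ i, (((![X] : Fin 1 → ℤ[X]) i).natDegree : ℝ)) : ℂ)) * (Complex.Gamma y)⁻¹ ^ 1)))) :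
    Λ 0 = 1 := by
  rw [eqOn_selbergDelangeOmegaF_of_omegaSegmentLaw_X hΛ hlaw (Metric.mem_ball_self two_pos),
    selbergDelangeOmegaF_zero]

end

end Summit.Parity.BatemanHorn.Theorems.LSDRealSegment.Negative
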